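import Mathlib
import HarnessLib
import Literature.Algebra.Polynomial.Subresultant
import Summits.ValiantsHypothesis.ValiantsHypothesis.Theorems.LacunarySymmetroidMatrixDescartesOsculationLawRankOneColumn

/-!
# ValiantsHypothesis / LacunarySymmetroid — crux `MatrixDescartes` (stmt-ValiantsHypothesis-18050, V1),
# line «osculation-law»: UNIFORM columns, part 3 — ISOBARIC determinants: monomial supports of subresultants

Fewnomial bookkeeping for the subresultants `σ_k(f,g) = det S_k` (von zur Gathen–Gerhard §6.10, the tree's
`Literature.Algebra.Polynomial.Subresultant.subresultant`) of two bivariate polynomials `f, g ∈ ℝ[t][b]` whose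
`b`-coefficients are ISOBARIC fewnomials in `t`: `supp_t (f_j) ⊆ (α − j) • E`, `supp_t (g_j) ⊆ (β − j) • E` for an
exponent alphabet `E` (`w • E` = sums of `w` elements of `E`).  Every entry of the Sylvester-type matrix `S_k` is a
coefficient `f_{k+i−j}` / `g_{k+i−j}` whose weight is (row value) − (column value) for suitable row/column values, so
EVERY permutation product in the Leibniz expansion has the same weight (`supp_det_isobaric`), whence
`supp σ_k ⊆ W • E` with `W ≤ n(β+n) + m(α+m)` (`supp_subresultant`), and `|supp σ_k| ≤ |E|^W`.  Also: isobaric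
families are closed under products and sums (`isobaric_mul`, `isobaric_add`, …), for the Hessian of a letter.

Honest framing: helper bookkeeping toward a UNIFORM Descartes ceiling for the osculation-law columns of an UNREGISTERED
V1 law line; `OsculationLaw` (all `m`), `PeelInequality`, `MatrixDescartes`, Conjecture B and `VP ≠ VNP` are OPEN /
NOT proved.  No definitions, no named facts; Mathlib + tree files only.
-/

-- `Summit.ValiantsHypothesis.ValiantsHypothesis.…` is the tree's mandated single-conjunct layout (Sub = Summit).
set_option linter.dupNamespace false

noncomputable section

namespace Summit.ValiantsHypothesis.ValiantsHypothesis.Theorems.LacunarySymmetroidMatrixDescartes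

namespace OsculationUniform

open Polynomial
open scoped BigOperators Pointwise
open Literature.Algebra.Polynomial.CofactorResultantBound Literature.Algebra.Polynomial.Subresultant

/-! ### Products with variable weights, isobaric determinants -/

/-- Finite products add the (variable) sumset weights. [folklore] -/
theorem supp_prod_weights {ι : Type*} (s : Finset ι) (f : ι → ℝ[X]) (w : ι → ℕ) {E : Finset ℕ}
    (h : ∀ i ∈ s, (f i).support ⊆ w i • E) : (∏ i ∈ s, f i).support ⊆ (∑ i ∈ s, w i) • E := by
  classical
  induction s using Finset.cons_induction with
  | empty =>
    intro n hn
    rw [Finset.prod_empty] at hn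
    rw [Finset.sum_empty, zero_nsmul]
    have : n = 0 := by
      by_contra hne
      rw [mem_support_iff, coeff_one] at hn
      exact hn (if_neg hne)
    rw [this]; exact Finset.mem_zero.2 rfl
  | cons a s ha ih =>
    rw [Finset.prod_cons, Finset.sum_cons]
    exact OsculationCusp.supp_mul (h a (Finset.mem_cons_self a s))
      (ih fun i hi => h i (Finset.mem_cons_of_mem hi))

/-- **Isobaric determinants.**  If entry `(i, j)` of a square matrix over `ℝ[X]` is `0` or has exponents in
`w • E` with `w + ρ i = γ j` (row values `ρ`, column values `γ`), then `supp det ⊆ (Σ γ − Σ ρ) • E` (every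
Leibniz product has weight `Σ γ − Σ ρ`; if `Σ γ < Σ ρ` every product vanishes). [folklore] -/
theorem supp_det_isobaric {ι : Type*} [Fintype ι] [DecidableEq ι] (E : Finset ℕ) (M : Matrix ι ι ℝ[X])
    (ρ γ : ι → ℕ) (hM : ∀ i j, M i j = 0 ∨ ∃ w : ℕ, w + ρ i = γ j ∧ (M i j).support ⊆ w • E) :
    M.det.support ⊆ (∑ j, γ j - ∑ i, ρ i) • E := by
  rw [Matrix.det_apply']
  refine OsculationTwoK.supp_sum _ _ fun σ _ => OsculationTwoK.supp_intCast_mul _ ?_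
  by_cases hz : ∃ i, M (σ i) i = 0
  · obtain ⟨i, hi⟩ := hz
    rw [Finset.prod_eq_zero (f := fun i => M (σ i) i) (Finset.mem_univ i) hi, support_zero]
    exact Finset.empty_subset _
  · push Not at hz
    have hw : ∀ i, ρ (σ i) ≤ γ i ∧ (M (σ i) i).support ⊆ (γ i - ρ (σ i)) • E := by
      intro i
      rcases hM (σ i) i with h | ⟨w, hw, hs⟩
      · exact absurd h (hz i)
      · have : w = γ i - ρ (σ i) := by omega
        exact ⟨by omega, this ▸ hs⟩
    have hprod := supp_prod_weights Finset.univ (fun i => M (σ i) i) (fun i => γ i - ρ (σ i)) fun i _ => (hw i).2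
    refine OsculationCusp.supp_cast hprod ?_
    rw [Finset.sum_tsub_distrib Finset.univ fun i _ => (hw i).1, Equiv.sum_comp σ ρ]

/-! ### The Sylvester-type matrices of two isobaric polynomials -/

/-- Entries of `sylvesterShift f g k a b` are `0` or isobaric coefficients, with row values `k + i` and column values
`β + j₁` (first `a` columns, coefficients of `g`) / `α + j₂` (last `b` columns, coefficients of `f`). [folklore] -/
theorem sylvesterShift_entry_isobaric (E : Finset ℕ) (f g : ℝ[X][X]) (α β : ℕ)
    (hf₁ : ∀ j, j ≤ α → (f.coeff j).support ⊆ (α - j) • E) (hf₂ : ∀ j, α < j → f.coeff j = 0)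
    (hg₁ : ∀ j, j ≤ β → (g.coeff j).support ⊆ (β - j) • E) (hg₂ : ∀ j, β < j → g.coeff j = 0)
    (k a b : ℕ) (i j : Fin (a + b)) :
    sylvesterShift f g k a b i j = 0 ∨ ∃ w : ℕ, w + (k + (i : ℕ)) =
      (if (j : ℕ) < a then β + (j : ℕ) else α + ((j : ℕ) - a)) ∧ (sylvesterShift f g k a b i j).support ⊆ w • E := by
  induction j using Fin.addCases with
  | left j₁ =>
    rw [sylvesterShift_apply_castAdd]
    simp only [Fin.val_castAdd, if_pos j₁.isLt]
    split_ifs with hle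
    · by_cases hβ : k + (i : ℕ) - (j₁ : ℕ) ≤ β
      · right
        refine ⟨β - (k + (i : ℕ) - (j₁ : ℕ)), by omega, hg₁ _ hβ⟩
      · left; exact hg₂ _ (by omega)
    · left; rfl
  | right j₂ =>
    rw [sylvesterShift_apply_natAdd]
    simp only [Fin.val_natAdd, if_neg (show ¬ (a + (j₂ : ℕ) < a) by omega), Nat.add_sub_cancel_left]
    split_ifs with hle
    · by_cases hα : k + (i : ℕ) - (j₂ : ℕ) ≤ α
      · right
        refine ⟨α - (k + (i : ℕ) - (j₂ : ℕ)), by omega, hf₁ _ hα⟩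
      · left; exact hf₂ _ (by omega)
    · left; rfl

/-- **Supports of subresultants of isobaric bivariate polynomials**: `supp σ_k(f,g) ⊆ W • E` with
`W ≤ n (β + n) + m (α + m)` (`n = deg_b f`, `m = deg_b g`). [folklore] -/
theorem supp_subresultant (E : Finset ℕ) (f g : ℝ[X][X]) (α β : ℕ)
    (hf₁ : ∀ j, j ≤ α → (f.coeff j).support ⊆ (α - j) • E) (hf₂ : ∀ j, α < j → f.coeff j = 0)
    (hg₁ : ∀ j, j ≤ β → (g.coeff j).support ⊆ (β - j) • E) (hg₂ : ∀ j, β < j → g.coeff j = 0) (k : ℕ) :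
    ∃ W : ℕ, W ≤ f.natDegree * (β + f.natDegree) + g.natDegree * (α + g.natDegree) ∧
      (subresultant f g k).support ⊆ W • E := by
  set a := f.natDegree - k with ha
  set b := g.natDegree - k with hb
  set γ : Fin (a + b) → ℕ := fun j => if (j : ℕ) < a then β + (j : ℕ) else α + ((j : ℕ) - a) with hγ
  set ρ : Fin (a + b) → ℕ := fun i => k + (i : ℕ) with hρ
  refine ⟨∑ j, γ j - ∑ i, ρ i, ?_, ?_⟩
  · refine (Nat.sub_le _ _).trans ?_
    rw [Fin.sum_univ_add]
    have h1 : ∑ j₁ : Fin a, γ (Fin.castAdd b j₁) ≤ a * (β + a) := by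
      calc ∑ j₁ : Fin a, γ (Fin.castAdd b j₁) ≤ ∑ _j₁ : Fin a, (β + a) := by
            refine Finset.sum_le_sum fun j₁ _ => ?_
            simp only [hγ, Fin.val_castAdd, if_pos j₁.isLt]
            have := j₁.isLt; omega
        _ = a * (β + a) := by rw [Finset.sum_const, Finset.card_univ, Fintype.card_fin, smul_eq_mul]
    have h2 : ∑ j₂ : Fin b, γ (Fin.natAdd a j₂) ≤ b * (α + b) := by
      calc ∑ j₂ : Fin b, γ (Fin.natAdd a j₂) ≤ ∑ _j₂ : Fin b, (α + b) := by
            refine Finset.sum_le_sum fun j₂ _ => ?_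
            simp only [hγ, Fin.val_natAdd, if_neg (show ¬ (a + (j₂ : ℕ) < a) by omega), Nat.add_sub_cancel_left]
            have := j₂.isLt; omega
        _ = b * (α + b) := by rw [Finset.sum_const, Finset.card_univ, Fintype.card_fin, smul_eq_mul]
    have haf : a ≤ f.natDegree := Nat.sub_le _ _
    have hbg : b ≤ g.natDegree := Nat.sub_le _ _
    calc ∑ j₁ : Fin a, γ (Fin.castAdd b j₁) + ∑ j₂ : Fin b, γ (Fin.natAdd a j₂)
        ≤ a * (β + a) + b * (α + b) := Nat.add_le_add h1 h2
      _ ≤ f.natDegree * (β + f.natDegree) + g.natDegree * (α + g.natDegree) :=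
          Nat.add_le_add (Nat.mul_le_mul haf (by omega)) (Nat.mul_le_mul hbg (by omega))
  · rw [subresultant_def]
    exact supp_det_isobaric E _ ρ γ fun i j =>
      sylvesterShift_entry_isobaric E f g α β hf₁ hf₂ hg₁ hg₂ k a b i j

/-- Monomial count: `|supp σ_k| ≤ |E| ^ (n (β + n) + m (α + m))` once `|E| ≥ 1`. [folklore] -/
theorem card_supp_subresultant_le (E : Finset ℕ) (hE : 1 ≤ E.card) (f g : ℝ[X][X]) (α β : ℕ)
    (hf₁ : ∀ j, j ≤ α → (f.coeff j).support ⊆ (α - j) • E) (hf₂ : ∀ j, α < j → f.coeff j = 0)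
    (hg₁ : ∀ j, j ≤ β → (g.coeff j).support ⊆ (β - j) • E) (hg₂ : ∀ j, β < j → g.coeff j = 0) (k : ℕ) :
    (subresultant f g k).support.card ≤ E.card ^ (f.natDegree * (β + f.natDegree) + g.natDegree * (α + g.natDegree)) := by
  obtain ⟨W, hW, hs⟩ := supp_subresultant E f g α β hf₁ hf₂ hg₁ hg₂ k
  exact (OsculationCusp.card_support_le_of_subset_nsmul hs).trans (Nat.pow_le_pow_right hE hW)

/-! ### Isobaric families: closure under the ring operations -/

/-- Products of isobaric polynomials are isobaric, weights add. [folklore] -/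
theorem isobaric_mul (E : Finset ℕ) (f g : ℝ[X][X]) (α β : ℕ)
    (hf₁ : ∀ j, j ≤ α → (f.coeff j).support ⊆ (α - j) • E) (hf₂ : ∀ j, α < j → f.coeff j = 0)
    (hg₁ : ∀ j, j ≤ β → (g.coeff j).support ⊆ (β - j) • E) (hg₂ : ∀ j, β < j → g.coeff j = 0) :
    (∀ j, j ≤ α + β → ((f * g).coeff j).support ⊆ (α + β - j) • E) ∧ (∀ j, α + β < j → (f * g).coeff j = 0) := by
  constructor
  · intro j hj
    rw [coeff_mul]
    refine OsculationTwoK.supp_sum _ _ fun x hx => ?_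
    rw [Finset.HasAntidiagonal.mem_antidiagonal] at hx
    by_cases h1 : x.1 ≤ α
    · by_cases h2 : x.2 ≤ β
      · exact OsculationCusp.supp_cast (OsculationCusp.supp_mul (hf₁ _ h1) (hg₁ _ h2)) (by omega)
      · rw [hg₂ _ (by omega), mul_zero, support_zero]; exact Finset.empty_subset _
    · rw [hf₂ _ (by omega), zero_mul, support_zero]; exact Finset.empty_subset _
  · intro j hj
    rw [coeff_mul]
    refine Finset.sum_eq_zero fun x hx => ?_
    rw [Finset.HasAntidiagonal.mem_antidiagonal] at hx
    by_cases h1 : x.1 ≤ α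
    · rw [hg₂ _ (by omega), mul_zero]
    · rw [hf₂ _ (by omega), zero_mul]

/-- Sums of isobaric polynomials of the same weight are isobaric. [folklore] -/
theorem isobaric_add (E : Finset ℕ) (f g : ℝ[X][X]) (α : ℕ)
    (hf₁ : ∀ j, j ≤ α → (f.coeff j).support ⊆ (α - j) • E) (hf₂ : ∀ j, α < j → f.coeff j = 0)
    (hg₁ : ∀ j, j ≤ α → (g.coeff j).support ⊆ (α - j) • E) (hg₂ : ∀ j, α < j → g.coeff j = 0) :
    (∀ j, j ≤ α → ((f + g).coeff j).support ⊆ (α - j) • E) ∧ (∀ j, α < j → (f + g).coeff j = 0) :=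
  ⟨fun j hj => by rw [coeff_add]; exact OsculationCusp.supp_add (hf₁ j hj) (hg₁ j hj),
    fun j hj => by rw [coeff_add, hf₂ j hj, hg₂ j hj, add_zero]⟩

/-- Differences of isobaric polynomials of the same weight are isobaric. [folklore] -/
theorem isobaric_sub (E : Finset ℕ) (f g : ℝ[X][X]) (α : ℕ)
    (hf₁ : ∀ j, j ≤ α → (f.coeff j).support ⊆ (α - j) • E) (hf₂ : ∀ j, α < j → f.coeff j = 0)
    (hg₁ : ∀ j, j ≤ α → (g.coeff j).support ⊆ (α - j) • E) (hg₂ : ∀ j, α < j → g.coeff j = 0) :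
    (∀ j, j ≤ α → ((f - g).coeff j).support ⊆ (α - j) • E) ∧ (∀ j, α < j → (f - g).coeff j = 0) :=
  ⟨fun j hj => by rw [coeff_sub]; exact OsculationCusp.supp_sub (hf₁ j hj) (hg₁ j hj),
    fun j hj => by rw [coeff_sub, hf₂ j hj, hg₂ j hj, sub_zero]⟩

/-- Numeral multiples of isobaric polynomials are isobaric. [folklore] -/
theorem isobaric_ofNat_mul (E : Finset ℕ) (f : ℝ[X][X]) (α : ℕ) (n : ℕ) [n.AtLeastTwo]
    (hf₁ : ∀ j, j ≤ α → (f.coeff j).support ⊆ (α - j) • E) (hf₂ : ∀ j, α < j → f.coeff j = 0) :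
    (∀ j, j ≤ α → (((OfNat.ofNat n : ℝ[X][X]) * f).coeff j).support ⊆ (α - j) • E) ∧
      (∀ j, α < j → ((OfNat.ofNat n : ℝ[X][X]) * f).coeff j = 0) := by
  have e : ∀ j, ((OfNat.ofNat n : ℝ[X][X]) * f).coeff j = (OfNat.ofNat n : ℝ[X]) * f.coeff j := by
    intro j
    rw [← map_ofNat C n, coeff_C_mul]
  exact ⟨fun j hj => by rw [e]; exact OsculationCusp.supp_ofNat_mul n (hf₁ j hj),
    fun j hj => by rw [e, hf₂ j hj, mul_zero]⟩

/-- **An explicit family is isobaric**: `Σ_{k ≤ n} C(c_k) X^k` with `supp c_k ⊆ (α − k) • E` (`k ≤ n ≤ α`).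
[folklore] -/
theorem isobaric_sum_C_mul_X_pow (E : Finset ℕ) (c : ℕ → ℝ[X]) (n α : ℕ) (hn : n ≤ α)
    (hc : ∀ k, k ≤ n → (c k).support ⊆ (α - k) • E) :
    (∀ j, j ≤ α → ((∑ k ∈ Finset.range (n + 1), C (c k) * X ^ k).coeff j).support ⊆ (α - j) • E) ∧
      (∀ j, α < j → (∑ k ∈ Finset.range (n + 1), C (c k) * X ^ k).coeff j = 0) := by
  have e : ∀ j, (∑ k ∈ Finset.range (n + 1), C (c k) * X ^ k : ℝ[X][X]).coeff j = if j ≤ n then c j else 0 := by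
    intro j
    rw [finsetSum_coeff]
    simp only [coeff_C_mul_X_pow]
    rw [Finset.sum_ite_eq (Finset.range (n + 1)) j c]
    simp only [Finset.mem_range, Nat.lt_succ_iff]
  constructor
  · intro j hj
    rw [e]
    split_ifs with h
    · exact hc j h
    · rw [support_zero]; exact Finset.empty_subset _
  · intro j hj
    rw [e, if_neg (by omega)]

/-- The leading coefficient of an isobaric polynomial. [folklore] -/
theorem supp_leadingCoeff_isobaric (E : Finset ℕ) (f : ℝ[X][X]) (α : ℕ)
    (hf₁ : ∀ j, j ≤ α → (f.coeff j).support ⊆ (α - j) • E) (hf₂ : ∀ j, α < j → f.coeff j = 0) :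
    f.leadingCoeff.support ⊆ (α - f.natDegree) • E := by
  by_cases h : f.natDegree ≤ α
  · exact hf₁ _ h
  · have h0 : f.leadingCoeff = 0 := hf₂ _ (by omega)
    rw [h0, support_zero]; exact Finset.empty_subset _

/-- An isobaric polynomial has `b`-degree at most its weight (or vanishes). [folklore] -/
theorem natDegree_le_of_isobaric (f : ℝ[X][X]) (α : ℕ)
    (hf₂ : ∀ j, α < j → f.coeff j = 0) : f.natDegree ≤ α := by
  by_contra h
  have h0 : f.leadingCoeff = 0 := hf₂ _ (by omega)
  rw [leadingCoeff_eq_zero] at h0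
  rw [h0, natDegree_zero] at h
  omega

end OsculationUniform

end Summit.ValiantsHypothesis.ValiantsHypothesis.Theorems.LacunarySymmetroidMatrixDescartes
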